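import Summits.ResolutionOfSingularities.ResolutionOfSingularities.Theorems.EquisingularLiftEquisingularLiftNatModelSquareRegularStalk
import HarnessLib

/-!
# EL♮(3), nose residue BY THE KERNEL: THE REDUCED TRACE OF A REGULAR `O`-FLAT MODEL HAS EMBEDDING DIMENSION ≤ dim + 1 AT EVERY POINT —
# the NO-GO behind NU7-NOSE-SIZING v1.2 §S Σ6 («no one-step door with reduced trace exists at a nose point of embedding dimension 3»)

res-L1-w45b-nose-w1 g6 (WIDTH seat D-0157 DOOR 1, nose residue `stub_elnat_three_nonisolated_…`).  res-L1-w45b-idea-2's NU7-NOSE-SIZING v1.2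
b47125f3e794221e §S Σ6 records, BY LETTERS, why a non-planar nose `Z` with a point of embedding dimension `3` (e.g. the space cusp
`t ↦ (t³, t⁴, t⁵)`) is OUTSIDE every door of the «blow `Z` up at once» family (ν3ᵈ DIRECT, ν4 EQUINODAL at its reached stage, any future sibling):
upstairs such a door needs the HEND block of ✓ `hsube_of_suppliers` / ✓ `noseRound_stage_of_model` — a REGULAR `O`-flat model `C` whose trace on the
special fibre is the REDUCED curve, `C.comap j = 𝓘⟨Z⟩` — and «if `𝒞 ⊂ X'` is a regular two-dimensional centre with `C.comap j = vanishingIdeal ⟨Z⟩`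
then `Z̃ = 𝒞 ×_{X'} F = 𝒞/ϖ𝒞` has embedding dimension ≤ 2 at every point» (NU7 §S Σ6: «the no-go is worth one line in the card (negative-side
lemma, cheap)»).  This module is that line IN THE KERNEL, in the chain's own currency (the MODEL SQUARE of ✓ …NatModelSquareRegularStalk /
✓ …NatFibreIntegral):

* `ModelSquare.spanFinrank_maximalIdeal_fibre_stalk_le` — model square over a DVR (`f : X → Spec O` flat, `X` locally Noetherian, `G` the special
  fibre, `j : G ⟶ X`): `𝒪_{X,j y}` regular ⇒ `μ(𝔪_{G,y}) ≤ dim 𝒪_{G,y} + 1` (`𝒪_{G,y} = 𝒪_{X,j y} ⧸ (ϖ̃)`, `μ(𝔪_X) = dim 𝒪_X = dim 𝒪_G + 1`).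
* `ModelSquare.spanFinrank_maximalIdeal_trace_stalk_le` — closed-subscheme form: `V(𝓦)` regular and `O`-flat ⇒ every stalk of the TRACE `V(𝓦·𝒪_G)`
  has `μ(𝔪) ≤ dim + 1` (the trace square is a model square, ✓ `FibreIntegral.isPullback_subschemeι_comap_model`).
* ★ `ModelSquare.not_exists_regular_flat_model_of_lt_spanFinrank` — hence a closed `Z ⊆ G` whose reduced structure `Z̃` has a point `z` with
  `dim 𝒪_{Z̃,z} + 1 < μ(𝔪_{Z̃,z})` admits NO ideal sheaf `C` on `X` with `V(C)` regular, `V(C) → Spec O` flat and `C.comap j = 𝓘⟨Z⟩`;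
* ★ `ModelSquare.hendBlock_false_of_lt_spanFinrank` — the same in the EXACT shape of the HEND block (✓ `hsube_of_suppliers` :105–:108 /
  ✓ `noseRound_stage_of_model`'s `hmodel`): at a downstairs stage `(F₂, T₂, Z₂)` with such a point NO upstairs stage-with-model exists, for ANY
  chain predicate `Ch`.  So Σ6 noses are residue for every one-step nose door by a KERNEL fact, not only by letters; what they need is an inner
  point-step prefix that lowers the embedding dimension first (NU7 §S Σ6, size L) — not typed here.

Elementary commutative algebra (Nakayama count under a surjection + `dim` drops by one modulo a regular parameter); no new fact; DEF-FREE; no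
`sorry`; standard axioms; `--supports stmt-ResolutionOfSingularities-20148 --as helper`, counted 0.  EL♮(3) is NOT proved here (this is a NEGATIVE-side
boundary lemma for the nose residue); resolution of singularities in positive characteristic is NOT proved anywhere in this tree (dim 3 in print:
Cossart–Piltant 2008/2009); nothing of [Hironaka2017] is asserted.
-/

set_option linter.dupNamespace false -- mandated namespace `Summit.<Summit>.<Problem>` of this single-conjunct summit

noncomputable section

open CategoryTheory CategoryTheory.Limits AlgebraicGeometry TopologicalSpace IsLocalRing
open Literature.AlgebraicGeometry.Resolution
open AlgebraicGeometry.Scheme.IdealSheafData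
open Summit.ResolutionOfSingularities.ResolutionOfSingularities.Cruxes.EquisingularLift.StrataSplit

namespace Summit.ResolutionOfSingularities.ResolutionOfSingularities.Cruxes.EquisingularLiftNat.Sections.ModelSquare

variable (O : Type) [CommRing O] [IsDomain O] [IsDiscreteValuationRing O] {k : Type} [Field k] (θ : O →+* k)
  (hθ : Function.Surjective θ) {X G : Scheme.{0}} (f : X ⟶ Spec (.of O)) (j : G ⟶ X) (t : G ⟶ Spec (.of k))
  (hsq : IsPullback j t f (Spec.map (CommRingCat.ofHom θ)))

include hθ hsq in
/-- **`μ(𝔪_{G,y}) ≤ dim 𝒪_{G,y} + 1` at a special-fibre point under a REGULAR point of the total space** (model square over a DVR, `f` flat,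
`X` locally Noetherian): `j♯_y : 𝒪_{X,j y} ↠ 𝒪_{G,y}` maps `𝔪` onto `𝔪`, so `μ(𝔪_G) ≤ μ(𝔪_X) = dim 𝒪_X = dim 𝒪_G + 1`
(✓ `ringKrullDim_stalk_eq_fibre_add_one`). [folklore; Nakayama count] -/
theorem spanFinrank_maximalIdeal_fibre_stalk_le [IsLocallyNoetherian X] [Flat f] (y : G)
    [IsRegularLocalRing (X.presheaf.stalk (j y))] :
    (((maximalIdeal (G.presheaf.stalk y)).spanFinrank : ℕ∞) : WithBot ℕ∞) ≤ ringKrullDim (G.presheaf.stalk y) + 1 := by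
  have hsurj := stalkMap_model_surjective θ hθ f j t hsq y
  have hmap : (maximalIdeal (X.presheaf.stalk (j y))).map (j.stalkMap y).hom = maximalIdeal (G.presheaf.stalk y) :=
    IsLocalRing.map_maximalIdeal_of_surjective _ hsurj
  have hfg : (maximalIdeal (X.presheaf.stalk (j y))).FG := (isNoetherianRing_iff_ideal_fg _).mp inferInstance _
  have hle : (maximalIdeal (G.presheaf.stalk y)).spanFinrank ≤ (maximalIdeal (X.presheaf.stalk (j y))).spanFinrank := by
    rw [← hmap]; exact Ideal.spanFinrank_map_le_of_fg _ hfg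
  have hX : (((maximalIdeal (X.presheaf.stalk (j y))).spanFinrank : ℕ∞) : WithBot ℕ∞) = ringKrullDim (X.presheaf.stalk (j y)) :=
    IsRegularLocalRing.spanFinrank_maximalIdeal
  rw [← ringKrullDim_stalk_eq_fibre_add_one O θ hθ f j t hsq y, ← hX]
  exact_mod_cast hle

include hθ hsq in
/-- **Closed-subscheme form: the TRACE of a regular `O`-flat closed subscheme has `μ(𝔪) ≤ dim + 1` at every point.**  For an ideal sheaf `𝓦` on `X`
with `V(𝓦)` regular and `V(𝓦) → Spec O` flat, every stalk of `V(𝓦·𝒪_G) = (𝓦.comap j).subscheme` satisfies `μ(𝔪) ≤ dim + 1` — the trace square is a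
model square (✓ `FibreIntegral.isPullback_subschemeι_comap_model`) and the previous lemma applies. [folklore] -/
theorem spanFinrank_maximalIdeal_trace_stalk_le [IsLocallyNoetherian X] (𝓦 : X.IdealSheafData)
    (hreg : Scheme.IsRegular 𝓦.subscheme) (hfl : Flat (𝓦.subschemeι ≫ f)) (y : ↥(𝓦.comap j).subscheme) :
    (((maximalIdeal ((𝓦.comap j).subscheme.presheaf.stalk y)).spanFinrank : ℕ∞) : WithBot ℕ∞) ≤
      ringKrullDim ((𝓦.comap j).subscheme.presheaf.stalk y) + 1 := by
  have hsqW := FibreIntegral.isPullback_subschemeι_comap_model O θ f j t hsq 𝓦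
  haveI : IsLocallyNoetherian 𝓦.subscheme := LocallyOfFiniteType.isLocallyNoetherian 𝓦.subschemeι
  haveI := hfl
  haveI : IsRegularLocalRing (𝓦.subscheme.presheaf.stalk (((𝓦.comapIso j).hom ≫ pullback.snd j 𝓦.subschemeι) y)) := hreg _
  exact spanFinrank_maximalIdeal_fibre_stalk_le O θ hθ (𝓦.subschemeι ≫ f) ((𝓦.comapIso j).hom ≫ pullback.snd j 𝓦.subschemeι)
    ((𝓦.comap j).subschemeι ≫ t) hsqW y

include hθ hsq in
/-- ★ **NO REGULAR `O`-FLAT MODEL WITH REDUCED TRACE AT A POINT OF EMBEDDING DIMENSION > dim + 1.**  If the reduced structure `Z̃` of a closed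
`Z ⊆ G` has a point `z` with `dim 𝒪_{Z̃,z} + 1 < μ(𝔪_{Z̃,z})` (e.g. a non-planar nose through a point of embedding dimension `3`: the space cusp
`(t³, t⁴, t⁵)`, `dim = 1`, `μ = 3`), then NO ideal sheaf `C` on `X` has `V(C)` regular, `V(C) → Spec O` flat and `C.comap j = 𝓘⟨Z⟩` — NU7 §S Σ6's
no-go in the kernel. [OURS · negative-side boundary lemma for the nose residue; counted 0; EL♮(3) NOT proved] -/
theorem not_exists_regular_flat_model_of_lt_spanFinrank [IsLocallyNoetherian X] (Z : Set G) (hZ : IsClosed Z)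
    (hz : ∃ z : ↥(vanishingIdeal (⟨Z, hZ⟩ : Closeds G)).subscheme, ringKrullDim ((vanishingIdeal (⟨Z, hZ⟩ : Closeds G)).subscheme.presheaf.stalk z) + 1 <
      (((maximalIdeal ((vanishingIdeal (⟨Z, hZ⟩ : Closeds G)).subscheme.presheaf.stalk z)).spanFinrank : ℕ∞) : WithBot ℕ∞)) :
    ¬ ∃ C : X.IdealSheafData, Scheme.IsRegular C.subscheme ∧ Flat (C.subschemeι ≫ f) ∧
      C.comap j = vanishingIdeal (⟨Z, hZ⟩ : Closeds G) := by
  rintro ⟨C, hreg, hfl, hCj⟩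
  obtain ⟨z, hz⟩ := hz
  have key : ∀ y : ↥(C.comap j).subscheme,
      (((maximalIdeal ((C.comap j).subscheme.presheaf.stalk y)).spanFinrank : ℕ∞) : WithBot ℕ∞) ≤
        ringKrullDim ((C.comap j).subscheme.presheaf.stalk y) + 1 :=
    spanFinrank_maximalIdeal_trace_stalk_le O θ hθ f j t hsq C hreg hfl
  rw [hCj] at key
  exact not_le.mpr hz (key z)

include hθ in
/-- ★ **THE HEND BLOCK IS EMPTY AT SUCH A STAGE** (✓ `hsube_of_suppliers` :105–:108 / ✓ `noseRound_stage_of_model`'s `hmodel`, verbatim shape):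
at a downstairs stage `(F₂, T₂, Z₂)` where `Z̃₂` has a point `z` with `dim 𝒪_{Z̃₂,z} + 1 < μ(𝔪_{Z̃₂,z})`, there is NO upstairs stage `(X', σ', S', j, t)`
over `(P, q : P → Spec O)` carrying a regular `O`-flat model `C` of `Z₂` with reduced trace — for ANY chain predicate `Ch` and any base `θ : O ↠ k`.
So no door of the «blow the nose up at once» family (ν3ᵈ, ν4's reached stage, …) has an upstairs twin at an embedding-dimension-3 nose point
(NU7-NOSE-SIZING v1.2 §S Σ6). [OURS · negative-side boundary lemma; counted 0; EL♮(3) NOT proved] -/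
theorem hendBlock_false_of_lt_spanFinrank (P : Scheme.{0}) (q : P ⟶ Spec (.of O))
    (Ch : ∀ X' : Scheme.{0}, (X' ⟶ P) → Set X' → Prop)
    (F₂ : Scheme.{0}) (T₂ Z₂ : Set F₂) (hZ₂ : IsClosed Z₂)
    (hz : ∃ z : ↥(vanishingIdeal (⟨Z₂, hZ₂⟩ : Closeds F₂)).subscheme, ringKrullDim ((vanishingIdeal (⟨Z₂, hZ₂⟩ : Closeds F₂)).subscheme.presheaf.stalk z) + 1 <
      (((maximalIdeal ((vanishingIdeal (⟨Z₂, hZ₂⟩ : Closeds F₂)).subscheme.presheaf.stalk z)).spanFinrank : ℕ∞) : WithBot ℕ∞)) :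
    ¬ ∃ (X' : Scheme.{0}) (σ' : X' ⟶ P) (S' : Set X') (j : F₂ ⟶ X') (t : F₂ ⟶ Spec (.of k)) (C : X'.IdealSheafData),
        Ch X' σ' S' ∧ IsIntegral X' ∧ IsLocallyNoetherian X' ∧ Scheme.IsRegular X' ∧ IsDominant (σ' ≫ q) ∧ IsIntegral F₂ ∧
        IsPullback j t (σ' ≫ q) (Spec.map (CommRingCat.ofHom θ)) ∧ IsClosed T₂ ∧ IsIrreducible T₂ ∧ j '' T₂ = S' ∧
        Scheme.IsRegular C.subscheme ∧ Flat (C.subschemeι ≫ σ' ≫ q) ∧ C.comap j = vanishingIdeal (⟨Z₂, hZ₂⟩ : Closeds F₂) := by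
  rintro ⟨X', σ', S', j, t, C, -, -, hX'noeth, -, -, -, hsq, -, -, -, hCreg, hCfl, hCj⟩
  haveI := hX'noeth
  exact not_exists_regular_flat_model_of_lt_spanFinrank O θ hθ (σ' ≫ q) j t hsq Z₂ hZ₂ hz ⟨C, hCreg, hCfl, hCj⟩

end Summit.ResolutionOfSingularities.ResolutionOfSingularities.Cruxes.EquisingularLiftNat.Sections.ModelSquare

end
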